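import Literature.NumberTheory.EllipticCurves.Kato2004.EulerSystemDefinedValues
import Summits.BirchSwinnertonDyer.Rank1Residual.Additive.PadicLogImage
import HarnessLib

/-!
# Route `KimAtThreeKolyvagin` (W2): the POSITION clause of the route's Kato hypotheses as a NAMED predicate, and the all-rows
# statement `KatoPeriodPositionAtThree` keyed on the Literature matrix `Kato2004.DefinedExpStarBody`
# (cell `bsd-addord`, seat w2-c4 gen 13; DEFINITIONS ONLY — two `def`s, no theorem, no named fact, no instance, no `sorry`)

HONEST FRAMING.  Nothing is asserted or proved here.  `KatoPosition` is a PREDICATE (parameters `W, d, κK`); `KatoPeriodPositionAtThree`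
is a closed `Prop` that the W2 route DISPLAYS as its own hypothesis (w2-c4 g12's hKatoPosʷ / w2-acc4 g6's hKatoPrintPos₀, consumers
19560 / 19077 / 19599 / 20397 / 20275) — written here in ≤ 10 lines over the Literature matrix so that the planner can REGISTER it as
the route's shared support item ('KatoPeriodPositionAtThree', planner g24 ROUTE-CARD 2026-08-27T16:47Z).  IT IS STRONGER THAN KATO'S
THEOREM: the Literature fact `Kato2004.exists_eulerSystem_definedExpStar_values` is «∃ d ι κK Λ, κK ≠ 0 ∧ DefinedExpStarBody …» WITHOUT
the position conjunct, and the position is NOT a consequence of it (w2-acc4 (T): `(d, 3κK, 3•z, 3•x)` satisfies the same matrix;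
w2-acc5 g8 kernel record).  Provenance of the position: the cell's reading (a″) — kim3 KIM3-POS-g16 Thm A / Cor B / Cor B′ (the 3-adic
position of Kato's generator against the Néron / duality line, `v₃(κ_W) = −v₃(c_P)`, i.e. the period comparison «Kato's optimal
period vs Ω⁺_f» of crux 19077's docstring; paper proof from print, NOT kernel-typable today: no modular-curve cohomology / `C_dR` in
the tree); print status PRE (Bullach–Honnor 2025 Thm 2.8 (b)(c) = Bullach–Burns 2025 Thm 9.2; mechanism Burns–Sakamoto–Sano III Rem. 6.9).
So every theorem keyed on `KatoPeriodPositionAtThree` is CONDITIONAL on it; nothing is closed or booked; BSD is NOT proved by any of this.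

WHAT.
* `KatoPosition W d κK` — POS_F(d, κK) in the currency of the Literature fact (w2-acc4 g6's text): `κK = u ∈ ℚ` and, for every scalar
  `e ≠ 0` of `ℚ_v` (`v = v_3`) such that the range of `exp*_d` on the `3`-adic cocycles of `T_3W|_{Γ_{ℚ_v}}`, read in `ℚ_3` and divided
  by `ι_3 e`, is the DUALITY ball `{a : ∀ Q ∈ W(ℚ_3), ‖a · log_ω Q‖ ≤ 1}`, one has `v_3(u) = v(ι_3 e)`.  Here `d` is a generator of
  `D⁰_dR(V_3W|_{Γ_{ℚ_v}})` in EXACTLY the type of the matrix's `d` (`FilZeroLine` of `restrictedRationalTateRep W ℚ_v 3` for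
  `bdRPeriodRingData`, `Place.Completion` spelling, the fact's `letI` chain), `expStarCoord` the fact's coordinate functional,
  `padicLog` the cell's formal-group logarithm on `W(ℚ_3)` (`Rank1Residual.Additive.PadicLogImage`).
* `KatoPeriodPositionAtThree` — for every `3`-adic-tower-surjective globally minimal `W` and every LATTICE-OPTIMAL modular
  parametrisation datum `P` at `N = conductor`: `∃ d ι κK Λ, κK ≠ 0 ∧ KatoPosition W d κK ∧ Kato2004.DefinedExpStarBody W 3 P.f d ι κK Λ`.
The bridge to hKatoPosʷ and the by-name consumers (19560 / 19077 / 19599 / 20275 / 20397 / route leaf) are in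
`Theorems/KimAtThreeShallowEqDeepOfPeriodPosition.lean` (same seat).
References: [Kato2004Asterisque] (8.1.3), 8.12, §9.4, 9.7, 6.6 (1), 13.3; [BlochKato1990] §3; [Kato1993LNM1553] II §1.2.4.
-/

noncomputable section

-- the cell's Theorems namespace `Summit.BirchSwinnertonDyer.BirchSwinnertonDyer.…` repeats the summit name by design (D-0017)
set_option linter.dupNamespace false

open scoped Classical NumberField TensorProduct Pointwise
open Field ValuativeRel Function IsDedekindDomain NumberField CongruenceSubgroup WeierstrassCurve
open Literature.NumberTheory.EllipticCurves
open Literature.NumberTheory.GaloisRepresentations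
open Literature.NumberTheory.GaloisRepresentations.PeriodRingData
open Literature.NumberTheory.GaloisRepresentations.IsNonarchimedeanLocalField
open Literature.NumberTheory.PAdicHodge Literature.NumberTheory.EllipticCurves.ModularForms
open Literature.NumberTheory.EllipticCurves.Kato2004 Literature.NumberTheory.EllipticCurves.Kato2004.EulerSystemValues
open Literature.NumberTheory.AdelicBaseChange Literature.NumberTheory.Automorphic
open Summit.BirchSwinnertonDyer.Rank1Residual.Additive.LocalLog
open Rat.HeightOneSpectrum

namespace Summit.BirchSwinnertonDyer.BirchSwinnertonDyer.Theorems.KimAtThreeShallowEqDeepPositionDefs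

-- The tree's `ℚ`-algebra structure on `ℚ_v = Place.Completion (inr v)` gets top priority LOCALLY, exactly as in the Literature
-- fact `Kato2004/EulerSystemDefinedValues.lean` (its `letI` chain keys on it; `Algebra ℚ _` is a subsingleton, nothing of Mathlib
-- is overridden) — so that the type of `d` below is syntactically the matrix's.
attribute [local instance 100001] NumberField.Place.instAlgebraCompletion

set_option backward.isDefEq.respectTransparency false in
/-- **The position clause `KatoPosition W d κK`** (POS_F(d, κK), in the currency of the Literature fact; w2-acc4 g6's text as a
named predicate): the real constant `κK` of Kato's value law (`ZetaBody` (C5)) is a rational number `u` whose `3`-adic valuation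
equals the valuation of EVERY scalar `e ≠ 0` of `ℚ_v` for which `(ι_3 e)⁻¹ · ι_3 ∘ exp*_d` maps the cocycles of `T_3W|_{Γ_{ℚ_v}}`
onto the duality ball `{a : ∀ Q ∈ W(ℚ_3), ‖a · log_ω Q‖ ≤ 1}` (i.e. `e • d` is duality-normalised).  The route's own hypothesis, NOT
Kato's theorem (module docstring).  A predicate; nothing asserted.
[cite: Kato2004Asterisque, §9.4 (p. 188), Thm. 9.7 (p. 189)] [cite: BlochKato1990, Def. 3.10 and Prop. 3.8] -/
def KatoPosition (W : WeierstrassCurve ℚ) [W.IsElliptic] [W.IsGloballyMinimal]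
    [ContinuousSMul ℤ_[3] (W.tateModule 3)] [Module.Free ℤ_[3] (W.tateModule 3)] [Module.Finite ℤ_[3] (W.tateModule 3)]
    (d :
      letI ρV := restrictedRationalTateRep W (NumberField.Place.Completion (Sum.inr ((Rat.HeightOneSpectrum.primesEquiv (R := 𝓞 ℚ)).symm ⟨3, Fact.out⟩) : NumberField.Place ℚ)) 3
      letI : ValuativeRel (NumberField.Place.Completion (Sum.inr ((Rat.HeightOneSpectrum.primesEquiv (R := 𝓞 ℚ)).symm ⟨3, Fact.out⟩) : NumberField.Place ℚ)) :=
        inferInstanceAs (ValuativeRel ((((Rat.HeightOneSpectrum.primesEquiv (R := 𝓞 ℚ)).symm ⟨3, Fact.out⟩)).adicCompletion ℚ))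
      letI : TopologicalSpace (NumberField.Place.Completion (Sum.inr ((Rat.HeightOneSpectrum.primesEquiv (R := 𝓞 ℚ)).symm ⟨3, Fact.out⟩) : NumberField.Place ℚ)) :=
        inferInstanceAs (TopologicalSpace ((((Rat.HeightOneSpectrum.primesEquiv (R := 𝓞 ℚ)).symm ⟨3, Fact.out⟩)).adicCompletion ℚ))
      haveI : IsNonarchimedeanLocalField (NumberField.Place.Completion (Sum.inr ((Rat.HeightOneSpectrum.primesEquiv (R := 𝓞 ℚ)).symm ⟨3, Fact.out⟩) : NumberField.Place ℚ)) :=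
        inferInstanceAs (IsNonarchimedeanLocalField ((((Rat.HeightOneSpectrum.primesEquiv (R := 𝓞 ℚ)).symm ⟨3, Fact.out⟩)).adicCompletion ℚ))
      haveI : CharZero (NumberField.Place.Completion (Sum.inr ((Rat.HeightOneSpectrum.primesEquiv (R := 𝓞 ℚ)).symm ⟨3, Fact.out⟩) : NumberField.Place ℚ)) := LocalField.charZero_adicCompletion ((Rat.HeightOneSpectrum.primesEquiv (R := 𝓞 ℚ)).symm ⟨3, Fact.out⟩)
      letI : Algebra ℚ_[3] (NumberField.Place.Completion (Sum.inr ((Rat.HeightOneSpectrum.primesEquiv (R := 𝓞 ℚ)).symm ⟨3, Fact.out⟩) : NumberField.Place ℚ)) :=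
        LocalField.adicCompletionPadicAlgebra ((Rat.HeightOneSpectrum.primesEquiv (R := 𝓞 ℚ)).symm ⟨3, Fact.out⟩) 3 ((natCast_mem_asIdeal_iff_eq_primesEquiv_symm _ Nat.prime_three).mpr rfl)
      haveI : Fact (¬ IsUnit ((3 : ℕ) : integerC (NumberField.Place.Completion (Sum.inr ((Rat.HeightOneSpectrum.primesEquiv (R := 𝓞 ℚ)).symm ⟨3, Fact.out⟩) : NumberField.Place ℚ)))) :=
        ⟨not_isUnit_natCast_integerC (show valuation (NumberField.Place.Completion (Sum.inr ((Rat.HeightOneSpectrum.primesEquiv (R := 𝓞 ℚ)).symm ⟨3, Fact.out⟩) : NumberField.Place ℚ)) ((3 : ℕ) : (NumberField.Place.Completion (Sum.inr ((Rat.HeightOneSpectrum.primesEquiv (R := 𝓞 ℚ)).symm ⟨3, Fact.out⟩) : NumberField.Place ℚ))) < 1 from LocalField.valuation_adicCompletion_natCast_lt_one ((Rat.HeightOneSpectrum.primesEquiv (R := 𝓞 ℚ)).symm ⟨3, Fact.out⟩) 3 ((natCast_mem_asIdeal_iff_eq_primesEquiv_symm _ Nat.prime_three).mpr rfl))⟩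
      haveI := isAdicComplete_integerC_natCast (show valuation (NumberField.Place.Completion (Sum.inr ((Rat.HeightOneSpectrum.primesEquiv (R := 𝓞 ℚ)).symm ⟨3, Fact.out⟩) : NumberField.Place ℚ)) ((3 : ℕ) : (NumberField.Place.Completion (Sum.inr ((Rat.HeightOneSpectrum.primesEquiv (R := 𝓞 ℚ)).symm ⟨3, Fact.out⟩) : NumberField.Place ℚ))) < 1 from LocalField.valuation_adicCompletion_natCast_lt_one ((Rat.HeightOneSpectrum.primesEquiv (R := 𝓞 ℚ)).symm ⟨3, Fact.out⟩) 3 ((natCast_mem_asIdeal_iff_eq_primesEquiv_symm _ Nat.prime_three).mpr rfl))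
      (bdRPeriodRingData (show valuation (NumberField.Place.Completion (Sum.inr ((Rat.HeightOneSpectrum.primesEquiv (R := 𝓞 ℚ)).symm ⟨3, Fact.out⟩) : NumberField.Place ℚ)) ((3 : ℕ) : (NumberField.Place.Completion (Sum.inr ((Rat.HeightOneSpectrum.primesEquiv (R := 𝓞 ℚ)).symm ⟨3, Fact.out⟩) : NumberField.Place ℚ))) < 1 from LocalField.valuation_adicCompletion_natCast_lt_one ((Rat.HeightOneSpectrum.primesEquiv (R := 𝓞 ℚ)).symm ⟨3, Fact.out⟩) 3 ((natCast_mem_asIdeal_iff_eq_primesEquiv_symm _ Nat.prime_three).mpr rfl))).FilZeroLine ρV)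
    (κK : ℝ) : Prop :=
  letI ρT := restrictedTateRep W (NumberField.Place.Completion (Sum.inr ((Rat.HeightOneSpectrum.primesEquiv (R := 𝓞 ℚ)).symm ⟨3, Fact.out⟩) : NumberField.Place ℚ)) 3
  letI : ValuativeRel (NumberField.Place.Completion (Sum.inr ((Rat.HeightOneSpectrum.primesEquiv (R := 𝓞 ℚ)).symm ⟨3, Fact.out⟩) : NumberField.Place ℚ)) :=
    inferInstanceAs (ValuativeRel ((((Rat.HeightOneSpectrum.primesEquiv (R := 𝓞 ℚ)).symm ⟨3, Fact.out⟩)).adicCompletion ℚ))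
  letI : TopologicalSpace (NumberField.Place.Completion (Sum.inr ((Rat.HeightOneSpectrum.primesEquiv (R := 𝓞 ℚ)).symm ⟨3, Fact.out⟩) : NumberField.Place ℚ)) :=
    inferInstanceAs (TopologicalSpace ((((Rat.HeightOneSpectrum.primesEquiv (R := 𝓞 ℚ)).symm ⟨3, Fact.out⟩)).adicCompletion ℚ))
  haveI : IsNonarchimedeanLocalField (NumberField.Place.Completion (Sum.inr ((Rat.HeightOneSpectrum.primesEquiv (R := 𝓞 ℚ)).symm ⟨3, Fact.out⟩) : NumberField.Place ℚ)) :=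
    inferInstanceAs (IsNonarchimedeanLocalField ((((Rat.HeightOneSpectrum.primesEquiv (R := 𝓞 ℚ)).symm ⟨3, Fact.out⟩)).adicCompletion ℚ))
  haveI : CharZero (NumberField.Place.Completion (Sum.inr ((Rat.HeightOneSpectrum.primesEquiv (R := 𝓞 ℚ)).symm ⟨3, Fact.out⟩) : NumberField.Place ℚ)) := LocalField.charZero_adicCompletion ((Rat.HeightOneSpectrum.primesEquiv (R := 𝓞 ℚ)).symm ⟨3, Fact.out⟩)
  letI : Algebra ℚ_[3] (NumberField.Place.Completion (Sum.inr ((Rat.HeightOneSpectrum.primesEquiv (R := 𝓞 ℚ)).symm ⟨3, Fact.out⟩) : NumberField.Place ℚ)) :=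
    LocalField.adicCompletionPadicAlgebra ((Rat.HeightOneSpectrum.primesEquiv (R := 𝓞 ℚ)).symm ⟨3, Fact.out⟩) 3 ((natCast_mem_asIdeal_iff_eq_primesEquiv_symm _ Nat.prime_three).mpr rfl)
  haveI : Fact (¬ IsUnit ((3 : ℕ) : integerC (NumberField.Place.Completion (Sum.inr ((Rat.HeightOneSpectrum.primesEquiv (R := 𝓞 ℚ)).symm ⟨3, Fact.out⟩) : NumberField.Place ℚ)))) :=
    ⟨not_isUnit_natCast_integerC (show valuation (NumberField.Place.Completion (Sum.inr ((Rat.HeightOneSpectrum.primesEquiv (R := 𝓞 ℚ)).symm ⟨3, Fact.out⟩) : NumberField.Place ℚ)) ((3 : ℕ) : (NumberField.Place.Completion (Sum.inr ((Rat.HeightOneSpectrum.primesEquiv (R := 𝓞 ℚ)).symm ⟨3, Fact.out⟩) : NumberField.Place ℚ))) < 1 from LocalField.valuation_adicCompletion_natCast_lt_one ((Rat.HeightOneSpectrum.primesEquiv (R := 𝓞 ℚ)).symm ⟨3, Fact.out⟩) 3 ((natCast_mem_asIdeal_iff_eq_primesEquiv_symm _ Nat.prime_three).mpr rfl))⟩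
  haveI := isAdicComplete_integerC_natCast (show valuation (NumberField.Place.Completion (Sum.inr ((Rat.HeightOneSpectrum.primesEquiv (R := 𝓞 ℚ)).symm ⟨3, Fact.out⟩) : NumberField.Place ℚ)) ((3 : ℕ) : (NumberField.Place.Completion (Sum.inr ((Rat.HeightOneSpectrum.primesEquiv (R := 𝓞 ℚ)).symm ⟨3, Fact.out⟩) : NumberField.Place ℚ))) < 1 from LocalField.valuation_adicCompletion_natCast_lt_one ((Rat.HeightOneSpectrum.primesEquiv (R := 𝓞 ℚ)).symm ⟨3, Fact.out⟩) 3 ((natCast_mem_asIdeal_iff_eq_primesEquiv_symm _ Nat.prime_three).mpr rfl))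
  ∃ u : ℚ, (u : ℝ) = κK ∧
    ∀ (e : (((Rat.HeightOneSpectrum.primesEquiv (R := 𝓞 ℚ)).symm ⟨3, Fact.out⟩)).adicCompletion ℚ), e ≠ 0 →
      (∀ a : ℚ_[3],
        (∃ η₀ : contOneCocycles ρT.toTopRep,
            (((Padic.adicCompletionEquiv (𝓞 ℚ) ⟨3, Fact.out⟩).symm : ((((Rat.HeightOneSpectrum.primesEquiv (R := 𝓞 ℚ)).symm ⟨3, Fact.out⟩)).adicCompletion ℚ) →+* ℚ_[3])) (expStarCoord W (show valuation (NumberField.Place.Completion (Sum.inr ((Rat.HeightOneSpectrum.primesEquiv (R := 𝓞 ℚ)).symm ⟨3, Fact.out⟩) : NumberField.Place ℚ)) ((3 : ℕ) : (NumberField.Place.Completion (Sum.inr ((Rat.HeightOneSpectrum.primesEquiv (R := 𝓞 ℚ)).symm ⟨3, Fact.out⟩) : NumberField.Place ℚ))) < 1 from LocalField.valuation_adicCompletion_natCast_lt_one ((Rat.HeightOneSpectrum.primesEquiv (R := 𝓞 ℚ)).symm ⟨3, Fact.out⟩) 3 ((natCast_mem_asIdeal_iff_eq_primesEquiv_symm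 _ Nat.prime_three).mpr rfl)) d η₀ : (NumberField.Place.Completion (Sum.inr ((Rat.HeightOneSpectrum.primesEquiv (R := 𝓞 ℚ)).symm ⟨3, Fact.out⟩) : NumberField.Place ℚ))) = (((Padic.adicCompletionEquiv (𝓞 ℚ) ⟨3, Fact.out⟩).symm : ((((Rat.HeightOneSpectrum.primesEquiv (R := 𝓞 ℚ)).symm ⟨3, Fact.out⟩)).adicCompletion ℚ) →+* ℚ_[3])) e * a) ↔
          ∀ Q : (W.baseChange ℚ_[3]).toAffine.Point, ‖a * padicLog (W.baseChange ℚ_[3]) Q‖ ≤ 1) →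
      padicValRat 3 u = ((((Padic.adicCompletionEquiv (𝓞 ℚ) ⟨3, Fact.out⟩).symm : ((((Rat.HeightOneSpectrum.primesEquiv (R := 𝓞 ℚ)).symm ⟨3, Fact.out⟩)).adicCompletion ℚ) →+* ℚ_[3])) e).valuation

/-- **`KatoPeriodPositionAtThree`** — the W2 route's ONE displayed non-cite statement as a NAMED proposition (text for the planner's
shared support item; consumers 19560 / 19077 / 19599 / 20397 / 20275): for every `3`-adic-tower-surjective globally minimal `W` and
every LATTICE-OPTIMAL modular parametrisation datum `P` at the conductor, Kato 2004's existential datum `(d, ι, κK, Λ)` (matrix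
`Kato2004.DefinedExpStarBody W 3 P.f d ι κK Λ` of the Literature fact `exists_eulerSystem_definedExpStar_values`) can be chosen WITH
the position clause `KatoPosition W d κK`.  STRONGER than the Literature fact (which has no position conjunct) and NOT a consequence of
it; the route's own hypothesis (provenance: the cell's reading (a″), KIM3-POS-g16 Thm A / Cor B′; print status PRE, module docstring).
Tagged `@[conjecture]`: an OPEN named statement of OUR theories (obligation node — a proof of it is a proof-of-item, `¬` it
refutes; the planner may register it as the route's own support item / premise), NOT a Literature fact.  Nothing asserted; no
`_holds` is claimed.  (References, deliberately not cite-tagged — this is NOT a statement of the literature: the matrix is Kato 2004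
Astérisque 295 (8.1.3), 8.12, §9.4, 9.7, 6.6 (1), 13.3 as typed in `Kato2004.DefinedExpStarBody`; the position is the cell's.) -/
@[conjecture] def KatoPeriodPositionAtThree : Prop :=
  ∀ (W : WeierstrassCurve ℚ) [W.IsElliptic] [W.IsGloballyMinimal]
    [ContinuousSMul ℤ_[3] (W.tateModule 3)] [Module.Free ℤ_[3] (W.tateModule 3)]
    [Module.Finite ℤ_[3] (W.tateModule 3)],
    (∀ m : ℕ, W.HasSurjectiveModNGaloisRep (3 ^ m : ℕ)) →
    ∀ {N : ℕ} [NeZero N] (P : ModularParametrizationData W N), N = W.conductorNorm ℤ →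
      (∀ z ∈ P.L.lattice, ∃ w ∈ periodLattice P.f, z = P.c * w) →
      ∃ d ι κK Λ, κK ≠ 0 ∧ KatoPosition W d κK ∧ Kato2004.DefinedExpStarBody W 3 P.f d ι κK Λ

end Summit.BirchSwinnertonDyer.BirchSwinnertonDyer.Theorems.KimAtThreeShallowEqDeepPositionDefs

end
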